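import Literature.NumberTheory.Rogawski1990.TestFunctions                         -- ★ `UnitaryGroup.PureTensor`, `PureTensor.IsArchTest`, `arch`, `archGroupGL`, `IsArchSmooth`
import Literature.Analysis.Calculus.SmoothAlongExp                               -- ★ `contDiffAt_of_contDiffAt_comp_mul_exp` (chart-wise smooth ⇒ smooth at a unit)
import Literature.NumberTheory.Automorphic.AutomorphicQuotientKernelConvolution  -- ★ `mulConv`, `mulStar`
import HarnessLib

/-!
# The archimedean test factor as a smooth compactly supported function on the matrix algebra `M_N(L ⊗ ℝ)`, and
# `∫ a(u) Ξ(x u) du = (Ξ ⋆ (a^∨)^*)(x)` (brick B7a of the road «DM∞»)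

Topic `NumberTheory/Automorphic`; namespace `Literature.NumberTheory.Automorphic.UnitaryGroup`.  THEOREMS ONLY (no definition, no instance, no
notation, no named fact, no `sorry`).  Brick (B7a) of the road «DM∞» (`F0/P3/p03/CENSUS-DMinf.F0P3p03g8.md`; F0P3-p03 (g8) spec 2026-08-31T20:51:44Z):
the glue between the tree's archimedean test currency ★ `PureTensor.IsArchTest` and the Banach-algebra class `𝒞` of the Dixmier–Malliavin steps
(★ `DixmierMalliavinStepBanach`: `ContDiff ℝ ∞ Θ ∧ HasCompactSupport Θ ∧ tsupport Θ ⊆ {M | IsUnit M}` on `A = M_N(L ⊗ ℝ)`), and the bookkeeping that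
turns `∫ a(u) Ξ(x u) dμ(u)` into the tree's convolution ★ `mulConv μ Ξ (mulStar (star ∘ a)) x`.

* §1 `exists_smooth_lift_of_isArchTest` — **THE LIFT**: for `T : PureTensor L N H` with `T.IsArchTest` (so `T.arch = φ|_{U(H)(L⁺ ⊗ ℝ)}`, `φ : GL_N(L ⊗ ℝ) → ℂ`
  continuous, compactly supported, `IsArchSmooth`), the zero-extension `Θ(M) = φ(M)` (`M` invertible), `= 0` (otherwise) is `C^∞` on the real Banach algebra
  `M_N(L ⊗ ℝ)` (at units: the logarithmic chart ★ `contDiffAt_of_contDiffAt_comp_mul_exp`, fed by `IsArchSmooth` for ★ `archGroupGL` whose Lie algebra is all of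
  `M_N`; off units: locally zero, since `val(tsupport φ)` is a compact set of units — the `contDiff_dite_isUnit` pattern of ★ `SmoothKernelGLArchParametricIntegral`),
  has compact support inside the units, and restricts to `T.arch` on `↥arch`.
* §2 `integral_mul_comp_mul_eq_mulConv` — for a LEFT-invariant measure `μ` on a group: `∫ a(u) Ξ(x u) dμ(u) = mulConv μ Ξ (mulStar (star ∘ a)) x`
  (`mulStar (star ∘ a) (w) = a(w⁻¹)`, substitution `u = x⁻¹ v`).
* §3 `exists_compactlySupported_restrict_arch` — a continuous compactly supported `Θ : M_N(L ⊗ ℝ) → ℂ` with `tsupport Θ ⊆ units` restricts along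
  `↥arch → GL_N(L ⊗ ℝ) → M_N(L ⊗ ℝ)` to a member of `C_c(↥arch, ℂ)` (`Units.val` is an open embedding of the units of a complete normed ring, ★ `isClosed_arch`).
HONEST LABEL: HC_CM is proved only modulo the printed citations until rung 0 closes; this file is unconditional plumbing (no debt).

## References
* J. Dixmier, P. Malliavin, *Factorisations de fonctions et de vecteurs indéfiniment différentiables*, Bull. Sci. Math. (2) 102 (1978), §3 Thm. 3.1
  [DixmierMalliavin1978].
* A. Borel, H. Jacquet, *Automorphic forms and automorphic representations*, PSPM 33.1 (1979), §1.1, §4.1 (smooth compactly supported test functions on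
  the archimedean group) [BorelJacquet1979].
* A. Deitmar, S. Echterhoff, *Principles of harmonic analysis*, 2nd ed. (2014), §1.6 (convolution on a locally compact group) [DeitmarEchterhoff2014].
-/

set_option autoImplicit false

noncomputable section

-- `Classical` is needed to see the Mathlib normed-space instances on `mixedSpace L` (note H5 of ★ `AdelicGLnGlue`); the Banach algebra
-- structure of `M_N(L ⊗ ℝ)` through which ★ `IsArchSmooth` is defined is the scoped operator norm
open scoped MatrixGroups Matrix ContDiff Classical Topology
open MeasureTheory NumberField NumberField.mixedEmbedding Filter Set Function

namespace Literature.NumberTheory.Automorphic.UnitaryGroup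

open scoped Matrix.Norms.Operator

/-! ## §1 The lift of an archimedean test factor to `M_N(L ⊗ ℝ)` -/

section Lift

variable {L : Type} [Field L] [NumberField L] [IsCMField L] {N : ℕ} {H : Matrix (Fin N) (Fin N) L}

omit [IsCMField L] in
-- `Matrix` is a type synonym of a pi type; its scoped Banach-algebra instances are found through it (idiom of ★ `SmoothKernelGLArchParametricIntegral`)
set_option backward.isDefEq.respectTransparency false in
/-- the zero-extension of an `IsArchSmooth` function on `GL_N(L ⊗ ℝ)` is `C^∞` at every unit (logarithmic chart at `u`; the chart function
`X ↦ φ(u · exp X)` is `C^∞` by `IsArchSmooth` for ★ `archGroupGL`, whose Lie algebra is all of `M_N`). [cite: BorelJacquet1979, §1.1 and §4.1] -/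
theorem contDiffAt_dite_isUnit_of_isArchSmooth {φ : GL (Fin N) (mixedSpace L) → ℂ}
    (hφ : IsArchSmooth (archGroupGL N L).carrier.subtype φ) (u : GL (Fin N) (mixedSpace L)) :
    ContDiffAt ℝ ∞ (fun q : Matrix (Fin N) (Fin N) (mixedSpace L) => if h : IsUnit q then φ h.unit else 0)
      (u : Matrix (Fin N) (Fin N) (mixedSpace L)) := by
  refine Literature.Analysis.Calculus.contDiffAt_of_contDiffAt_comp_mul_exp u ?_
  letI : LieRing (Matrix (Fin N) (Fin N) (mixedSpace L)) := LieRing.ofAssociativeRing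
  letI : LieAlgebra ℝ (Matrix (Fin N) (Fin N) (mixedSpace L)) := LieAlgebra.ofAssociativeAlgebra
  have hmem : ∀ x : Matrix (Fin N) (Fin N) (mixedSpace L), x ∈ (archGroupGL N L).lie.toSubmodule := fun x => by
    change x ∈ (archGroupGL N L).lie
    rw [archGroupGL_lie]
    exact LieSubalgebra.mem_top x
  let incl : Matrix (Fin N) (Fin N) (mixedSpace L) →L[ℝ] (archGroupGL N L).lie.toSubmodule :=
    { toFun := fun x => ⟨x, hmem x⟩
      map_add' := fun _ _ => rfl
      map_smul' := fun _ _ => rfl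
      cont := continuous_id.subtype_mk _ }
  -- the chart function at the base point `u`, as `IsArchSmooth` delivers it
  have hsm : ContDiff ℝ ∞ fun X : (archGroupGL N L).lie.toSubmodule =>
      φ (u * (archGroupGL N L).carrier.subtype ((archGroupGL N L).expMem ⟨X, X.2⟩)) := hφ u
  have hcomp := hsm.comp incl.contDiff
  have heq : (fun X : Matrix (Fin N) (Fin N) (mixedSpace L) =>
      (fun q : Matrix (Fin N) (Fin N) (mixedSpace L) => if h : IsUnit q then φ h.unit else 0)
        ((u : Matrix (Fin N) (Fin N) (mixedSpace L)) * NormedSpace.exp X)) =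
      (fun X : (archGroupGL N L).lie.toSubmodule =>
        φ (u * (archGroupGL N L).carrier.subtype ((archGroupGL N L).expMem ⟨X, X.2⟩))) ∘ (incl : Matrix (Fin N) (Fin N) (mixedSpace L) → _) := by
    funext X
    change (fun q : Matrix (Fin N) (Fin N) (mixedSpace L) => if h : IsUnit q then φ h.unit else 0)
        ((u : Matrix (Fin N) (Fin N) (mixedSpace L)) * NormedSpace.exp X) = φ (u * expGL X)
    have hX : ((u : Matrix (Fin N) (Fin N) (mixedSpace L)) * NormedSpace.exp X : Matrix (Fin N) (Fin N) (mixedSpace L)) =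
        ((u * expGL X : GL (Fin N) (mixedSpace L)) : Matrix (Fin N) (Fin N) (mixedSpace L)) := by
      rw [Units.val_mul, coe_expGL]
    rw [hX]
    change (if h : IsUnit ((u * expGL X : GL (Fin N) (mixedSpace L)) : Matrix (Fin N) (Fin N) (mixedSpace L)) then φ h.unit else 0) = _
    rw [dif_pos (Units.isUnit _), IsUnit.unit_of_val_units]
  rw [heq]
  exact hcomp.contDiffAt

omit [NumberField L] [IsCMField L] in
/-- off the compact set `val(tsupport φ)` of units, the zero-extension vanishes; in particular it is locally zero at every non-unit.
[cite: BorelJacquet1979, §4.1] -/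
theorem dite_isUnit_eq_zero_of_notMem {φ : GL (Fin N) (mixedSpace L) → ℂ} {q : Matrix (Fin N) (Fin N) (mixedSpace L)}
    (hq : q ∉ (fun z : GL (Fin N) (mixedSpace L) => (z : Matrix (Fin N) (Fin N) (mixedSpace L))) '' tsupport φ) :
    (if h : IsUnit q then φ h.unit else 0) = 0 := by
  by_cases h : IsUnit q
  · rw [dif_pos h]
    by_contra hne
    exact hq ⟨h.unit, subset_tsupport _ hne, IsUnit.unit_spec h⟩
  · rw [dif_neg h]

/-- **THE LIFT OF AN ARCHIMEDEAN TEST FACTOR TO THE MATRIX ALGEBRA.**  For a pure tensor `T` with `T.IsArchTest` there is `Θ : M_N(L ⊗ ℝ) → ℂ`,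
`C^∞` on the real Banach algebra `M_N(L ⊗ ℝ)` (operator norm), compactly supported INSIDE THE UNITS, with `T.arch k = Θ(k)` along
`↥arch → GL_N(L ⊗ ℝ) → M_N(L ⊗ ℝ)` — i.e. `T.arch` read as a member of the class `𝒞` of ★ `DixmierMalliavinStepBanach` ([DixmierMalliavin1978 Thm. 3.1] for the Lie
group `U(H)(L⁺ ⊗ ℝ)` is then run on `Θ`).  `Θ` is the zero-extension of the `φ` of `IsArchTest`: smooth at units by the logarithmic chart, locally zero at
non-units, support = `val(tsupport φ)` compact. [cite: BorelJacquet1979, §1.1 and §4.1] [cite: DixmierMalliavin1978, §3 Thm. 3.1] -/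
theorem exists_smooth_lift_of_isArchTest (T : PureTensor L N H) (hT : T.IsArchTest) :
    ∃ Θ : Matrix (Fin N) (Fin N) (mixedSpace L) → ℂ, ContDiff ℝ ∞ Θ ∧ HasCompactSupport Θ ∧ tsupport Θ ⊆ {M | IsUnit M} ∧
      ∀ k : arch (↥(maximalRealSubfield L)) L (IsCMField.complexConj L) N H,
        T.arch k = Θ ((k : GL (Fin N) (mixedSpace L)) : Matrix (Fin N) (Fin N) (mixedSpace L)) := by
  obtain ⟨φ, hφc, hφs, hφsm, hφT⟩ := hT
  -- the compact set of units carrying the support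
  obtain ⟨C, hCdef⟩ : ∃ C : Set (Matrix (Fin N) (Fin N) (mixedSpace L)),
      C = (fun z : GL (Fin N) (mixedSpace L) => (z : Matrix (Fin N) (Fin N) (mixedSpace L))) '' tsupport φ := ⟨_, rfl⟩
  have hCc : IsCompact C := by rw [hCdef]; exact hφs.image Units.continuous_val
  have hCu : C ⊆ {M | IsUnit M} := by
    rw [hCdef]; rintro _ ⟨z, -, rfl⟩; exact Units.isUnit z
  refine ⟨fun q => if h : IsUnit q then φ h.unit else 0, ?_, ?_, ?_, fun k => ?_⟩
  · rw [contDiff_iff_contDiffAt]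
    intro q
    by_cases h : IsUnit q
    · obtain ⟨u, rfl⟩ := h
      exact contDiffAt_dite_isUnit_of_isArchSmooth hφsm u
    · have hqC : q ∉ C := fun h' => h (hCu h')
      refine (contDiffAt_const (c := (0 : ℂ))).congr_of_eventuallyEq ?_
      filter_upwards [hCc.isClosed.isOpen_compl.mem_nhds hqC] with q' hq'
      exact dite_isUnit_eq_zero_of_notMem (by rw [hCdef] at hq'; exact hq')
  · exact HasCompactSupport.intro hCc fun q hq => dite_isUnit_eq_zero_of_notMem (by rw [hCdef] at hq; exact hq)
  · refine (closure_minimal (fun q hq => ?_) hCc.isClosed).trans hCu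
    by_contra hqC
    exact hq (dite_isUnit_eq_zero_of_notMem (by rw [hCdef] at hqC; exact hqC))
  · change T.arch k = (if h : IsUnit ((k : GL (Fin N) (mixedSpace L)) : Matrix (Fin N) (Fin N) (mixedSpace L)) then φ h.unit else 0)
    rw [dif_pos (Units.isUnit _), IsUnit.unit_of_val_units]
    exact hφT k

end Lift

/-! ## §2 `∫ a(u) Ξ(x u) dμ(u)` as a convolution -/

section Conv

variable {G : Type*} [Group G] [MeasurableSpace G] [MeasurableMul G] (μ : Measure G) [μ.IsMulLeftInvariant]

/-- **`∫ a(u) Ξ(x u) dμ(u) = (Ξ ⋆ (a^∨)^*)(x)`** for a LEFT-invariant `μ`: `mulStar (star ∘ a) (w) = a(w⁻¹)`, so `mulConv μ Ξ (mulStar (star ∘ a)) x = ∫ Ξ(v) a(x⁻¹ v) dμ(v)`,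
and `v = x u`. [cite: DeitmarEchterhoff2014, §1.6] -/
theorem integral_mul_comp_mul_eq_mulConv (a Ξ : G → ℂ) (x : G) :
    (∫ u, a u * Ξ (x * u) ∂μ) = mulConv μ Ξ (mulStar (star ∘ a)) x := by
  rw [mulConv_apply]
  have h : (fun v : G => Ξ v * mulStar (star ∘ a) (v⁻¹ * x)) = fun v => a (x⁻¹ * v) * Ξ v := by
    funext v
    rw [mulStar_apply, Function.comp_apply, mul_inv_rev, inv_inv, starRingEnd_apply, star_star, mul_comm]
  rw [h, ← integral_mul_left_eq_self (fun v => a (x⁻¹ * v) * Ξ v) x]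
  refine integral_congr_ae (Eventually.of_forall fun u => ?_)
  simp only [inv_mul_cancel_left]

end Conv

/-! ## §3 Restriction of a member of `𝒞` to `↥arch` as a member of `C_c(↥arch, ℂ)` -/

section Restrict

variable {L : Type} [Field L] [NumberField L] [IsCMField L] {N : ℕ} {H : Matrix (Fin N) (Fin N) L}

/-- **RESTRICTION TO THE UNITARY GROUP**: a continuous compactly supported `Θ : M_N(L ⊗ ℝ) → ℂ` with `tsupport Θ ⊆ units` restricts along
`↥arch → GL_N(L ⊗ ℝ) → M_N(L ⊗ ℝ)` to a member of `C_c(U(H)(L⁺ ⊗ ℝ), ℂ)` (`Units.val` is an open embedding of the units of the complete normed ring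
`M_N(L ⊗ ℝ)`, so the preimage of the compact `tsupport Θ ⊆ units` is compact in `GL`; ★ `isClosed_arch`). [cite: BorelJacquet1979, §4.1] -/
theorem exists_compactlySupported_restrict_arch (Θ : Matrix (Fin N) (Fin N) (mixedSpace L) → ℂ) (hΘ : Continuous Θ)
    (hc : HasCompactSupport Θ) (hU : tsupport Θ ⊆ {M | IsUnit M}) :
    ∃ a : CompactlySupportedContinuousMap (arch (↥(maximalRealSubfield L)) L (IsCMField.complexConj L) N H) ℂ,
      ∀ k, a k = Θ ((k : GL (Fin N) (mixedSpace L)) : Matrix (Fin N) (Fin N) (mixedSpace L)) := by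
  have hval : Topology.IsInducing (Units.val : GL (Fin N) (mixedSpace L) → Matrix (Fin N) (Fin N) (mixedSpace L)) :=
    Units.isOpenEmbedding_val.isInducing
  have hK : IsCompact ((Units.val : GL (Fin N) (mixedSpace L) → Matrix (Fin N) (Fin N) (mixedSpace L)) ⁻¹' tsupport Θ) := by
    refine hval.isCompact_preimage' hc.isCompact fun M hM => ?_
    exact ⟨(hU hM).unit, IsUnit.unit_spec (hU hM)⟩
  have hK' : IsCompact ((Subtype.val : arch (↥(maximalRealSubfield L)) L (IsCMField.complexConj L) N H → GL (Fin N) (mixedSpace L)) ⁻¹'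
      ((Units.val : GL (Fin N) (mixedSpace L) → Matrix (Fin N) (Fin N) (mixedSpace L)) ⁻¹' tsupport Θ)) :=
    (Topology.IsClosedEmbedding.subtypeVal (isClosed_arch (↥(maximalRealSubfield L)) L (IsCMField.complexConj L) N H)).isCompact_preimage hK
  have hcont : Continuous fun k : arch (↥(maximalRealSubfield L)) L (IsCMField.complexConj L) N H =>
      Θ ((k : GL (Fin N) (mixedSpace L)) : Matrix (Fin N) (Fin N) (mixedSpace L)) :=
    hΘ.comp (Units.continuous_val.comp continuous_subtype_val)
  have hsupp : HasCompactSupport fun k : arch (↥(maximalRealSubfield L)) L (IsCMField.complexConj L) N H =>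
      Θ ((k : GL (Fin N) (mixedSpace L)) : Matrix (Fin N) (Fin N) (mixedSpace L)) :=
    HasCompactSupport.intro hK' fun k hk => image_eq_zero_of_notMem_tsupport hk
  exact ⟨⟨⟨_, hcont⟩, hsupp⟩, fun k => rfl⟩

end Restrict

end Literature.NumberTheory.Automorphic.UnitaryGroup

end
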